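import Literature.AlgebraicGeometry.Motives.MixedHodgeStructureSemisimpleSums
import HarnessLib

/-!
# Simple mixed Hodge structures are pure; Schur's lemma

Cattani–El Zein–Griffiths–Lê (eds.), *Hodge Theory*: the category of mixed Hodge structures is abelian
(Thm. 3.2.18), "simple := irreducible := no nontrivial subobject" (p. 270), the weight filtration is a filtration by
sub-objects (Prop. 3.2.19 / Lemma 3.2.20; the tree's `SubMixedHodgeStructure.weight`), and `Gr^W` is faithful and
exact (Thm. 3.2.18 (iii)). Consequences for the simple objects `IsSimple` of `MixedHodgeStructureSemisimpleSums`
(namespace `MixedHodgeStructure`; everything proved, no named facts):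

* §1 **`IsSimple.exists_isPure`** — a simple MHS is pure of some weight `n` (`W_k ∈ {0, V}` for all `k`), and is
  isomorphic to its graded piece `Gr^W_n` regarded as an MHS (`IsPure.exists_hom_gr_bijective`); the weights of a
  pure MHS (`IsPure.eq_of_isWeight`) and **`IsPure.hom_eq_zero_of_ne`**: morphisms between pure MHS of different
  weights vanish.
* §2 **Schur's lemma**: a morphism out of (into) a simple MHS is zero or injective (surjective)
  (`IsSimple.injective_or_eq_zero`, `IsSimple.surjective_or_eq_zero`); between simple MHS it is zero or an
  isomorphism (`IsSimple.bijective_or_eq_zero`); a non-zero endomorphism of a simple MHS is invertible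
  (`IsSimple.exists_inverse_of_ne_zero`).
* §3 the pure dictionary: `HodgeStructure.isSimple_toMixedHodgeStructure_iff`.

## References

* [CattaniElZeinGriffithsLe2014] E. Cattani et al. (eds.), Hodge Theory (2014), Thm. 3.2.18, Prop. 3.2.19,
  Lemma 3.2.20, Ex. 3.2.23 (1), p. 270.
* [PetersSteenbrink2008] C. Peters, J. Steenbrink, Mixed Hodge Structures (2008), Cor. 3.6–3.8 (morphisms and
  the weight filtration; `Gr^W` exact).
-/

noncomputable section

open scoped TensorProduct

namespace Literature.AlgebraicGeometry.Motives

namespace MixedHodgeStructure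

universe u v

variable {V : Type u} [AddCommGroup V] [Module ℚ V]
variable {V' : Type v} [AddCommGroup V'] [Module ℚ V']
variable {H : MixedHodgeStructure V} {H' : MixedHodgeStructure V'}

/-! ### §1 Simple mixed Hodge structures are pure -/

/-- If every `W_k` is `0` or `V` (and `V ≠ 0`) then `H` is pure of some weight: the least `k` with `W_k = V`.
[cite: CattaniElZeinGriffithsLe2014, Ex. 3.2.23 (1)] -/
theorem exists_isPure_of_forall_W_eq_bot_or_eq_top [Nontrivial V] (h : ∀ k : ℤ, H.W k = ⊥ ∨ H.W k = ⊤) :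
    ∃ n, H.IsPure n := by
  obtain ⟨k₀, hk₀⟩ := H.exists_W_eq_bot
  obtain ⟨k₁, hk₁⟩ := H.exists_W_eq_top
  have hbdd : ∀ k, H.W k = ⊤ → k₀ ≤ k := fun k hk => by
    by_contra hlt
    have hle : H.W k ≤ H.W k₀ := H.monotone_W (le_of_not_ge hlt)
    rw [hk, hk₀, top_le_iff] at hle
    exact bot_ne_top hle
  obtain ⟨n, hn, hmin⟩ := Int.exists_least_of_bdd ⟨k₀, hbdd⟩ ⟨k₁, hk₁⟩
  refine ⟨n, fun k hk => ?_, fun k hk => eq_top_iff.2 (hn ▸ H.monotone_W hk)⟩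
  rcases h k with hb | ht
  · exact hb
  · exact absurd (hmin k ht) (not_le.2 hk)

/-- **A simple mixed Hodge structure is pure** (of a unique weight). [cite: CattaniElZeinGriffithsLe2014, Prop. 3.2.19 and p. 270] -/
theorem IsSimple.exists_isPure (h : H.IsSimple) : ∃ n, H.IsPure n := by
  haveI := h.nontrivial
  exact exists_isPure_of_forall_W_eq_bot_or_eq_top h.W_eq_bot_or_eq_top

/-- The only weight of a pure MHS of weight `n` is `n`. [cite: CattaniElZeinGriffithsLe2014, Ex. 3.2.23 (1)] -/
theorem IsPure.eq_of_isWeight {n k : ℤ} (hp : H.IsPure n) (hk : H.IsWeight k) : k = n := by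
  by_contra hne
  rcases lt_or_gt_of_ne hne with hlt | hgt
  · exact (ne_of_lt hk) (by rw [hp.1 (k - 1) (by omega), hp.1 k hlt])
  · exact (ne_of_lt hk) (by rw [hp.2 (k - 1) (by omega), hp.2 k (by omega)])

/-- A pure MHS of weight `n` on a non-zero space has `n` as a weight. [cite: CattaniElZeinGriffithsLe2014, Ex. 3.2.23 (1)] -/
theorem IsPure.isWeight [Nontrivial V] {n : ℤ} (hp : H.IsPure n) : H.IsWeight n := by
  change H.W (n - 1) < H.W n
  rw [hp.1 (n - 1) (by omega), hp.2 n le_rfl]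
  exact bot_lt_top

/-- The weight of a pure MHS on a non-zero space is unique. [cite: CattaniElZeinGriffithsLe2014, Ex. 3.2.23 (1)] -/
theorem IsPure.unique [Nontrivial V] {n m : ℤ} (hn : H.IsPure n) (hm : H.IsPure m) : n = m :=
  hm.eq_of_isWeight hn.isWeight

/-- **Morphisms between pure mixed Hodge structures of different weights vanish** (`Gr^W` is faithful and the two
structures have no weight in common). [cite: CattaniElZeinGriffithsLe2014, Thm. 3.2.18 (iii)] [cite: PetersSteenbrink2008, Cor. 3.8] -/
theorem IsPure.hom_eq_zero_of_ne {n m : ℤ} (hp : H.IsPure n) (hp' : H'.IsPure m) (hnm : n ≠ m) (f : Hom H H') :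
    f = Hom.zero H H' :=
  f.eq_zero_of_forall_not_isWeight fun _ hk hk' => hnm ((hp.eq_of_isWeight hk).symm.trans (hp'.eq_of_isWeight hk'))

/-- **A pure MHS of weight `n` is isomorphic to its graded piece `Gr^W_n` regarded as an MHS**
(`W_{n-1} = 0`, `W_n = V`). [cite: CattaniElZeinGriffithsLe2014, Ex. 3.2.23 (1)] -/
theorem IsPure.exists_hom_gr_bijective {n : ℤ} (hp : H.IsPure n) :
    ∃ f : Hom (H.gr n).toMixedHodgeStructure H, Function.Bijective f.toLinearMap := by
  have hbot : subPiece H.W n = ⊥ := by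
    rw [subPiece, Submodule.submoduleOf, hp.1 (n - 1) (by omega), Submodule.comap_bot, Submodule.ker_subtype]
  have hker : subPiece H.W n ≤ LinearMap.ker (SubMixedHodgeStructure.weight H n).subtype.toLinearMap := by
    rw [hbot]; exact bot_le
  refine ⟨SubMixedHodgeStructure.grLift H n (SubMixedHodgeStructure.weight H n).subtype hker, ?_, ?_⟩
  · rw [← LinearMap.ker_eq_bot]
    exact Submodule.ker_liftQ_eq_bot _ _ _ (fun x hx => by
      rw [LinearMap.mem_ker] at hx
      rw [show x = 0 from Subtype.ext hx]
      exact Submodule.zero_mem _)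
  · intro v
    refine ⟨Submodule.Quotient.mk ⟨v, by rw [hp.2 n le_rfl]; exact Submodule.mem_top⟩, rfl⟩

/-- A simple MHS is isomorphic to a pure Hodge structure (its unique non-zero graded piece) regarded as an MHS.
[cite: CattaniElZeinGriffithsLe2014, Ex. 3.2.23 (1) and p. 270] -/
theorem IsSimple.exists_hom_gr_bijective (h : H.IsSimple) :
    ∃ (n : ℤ) (f : Hom (H.gr n).toMixedHodgeStructure H), Function.Bijective f.toLinearMap := by
  obtain ⟨n, hp⟩ := h.exists_isPure
  obtain ⟨f, hf⟩ := hp.exists_hom_gr_bijective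
  exact ⟨n, f, hf⟩

/-! ### §2 Schur's lemma -/

/-- The zero morphism has zero underlying map (by `rfl`). [cite: CattaniElZeinGriffithsLe2014, Thm. 3.2.18] -/
theorem Hom.zero_toLinearMap (H : MixedHodgeStructure V) (H' : MixedHodgeStructure V') :
    (Hom.zero H H').toLinearMap = 0 := rfl

/-- A morphism is zero iff its kernel is everything. [cite: CattaniElZeinGriffithsLe2014, Thm. 3.2.18] -/
theorem Hom.eq_zero_iff_ker_eq_top (f : Hom H H') : f = Hom.zero H H' ↔ f.ker.toSubmodule = ⊤ := by
  rw [Hom.ker_toSubmodule, LinearMap.ker_eq_top]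
  exact ⟨fun h => by rw [h]; rfl, fun h => Hom.ext h⟩

/-- A morphism is zero iff its image is zero. [cite: CattaniElZeinGriffithsLe2014, Thm. 3.2.18] -/
theorem Hom.eq_zero_iff_range_eq_bot (f : Hom H H') : f = Hom.zero H H' ↔ f.range.toSubmodule = ⊥ := by
  rw [Hom.range_toSubmodule, LinearMap.range_eq_bot]
  exact ⟨fun h => by rw [h]; rfl, fun h => Hom.ext h⟩

/-- **Schur (source)**: a morphism out of a simple MHS is injective or zero (its kernel is a sub-MHS).
[cite: CattaniElZeinGriffithsLe2014, Thm. 3.2.18 and p. 270] -/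
theorem IsSimple.injective_or_eq_zero (h : H.IsSimple) (f : Hom H H') :
    Function.Injective f.toLinearMap ∨ f = Hom.zero H H' := by
  rcases h.eq_bot_or_eq_top f.ker with h0 | h1
  · left; rw [← LinearMap.ker_eq_bot, ← Hom.ker_toSubmodule]; exact h0
  · right; exact f.eq_zero_iff_ker_eq_top.2 h1

/-- **Schur (target)**: a morphism into a simple MHS is surjective or zero (its image is a sub-MHS).
[cite: CattaniElZeinGriffithsLe2014, Thm. 3.2.18 and p. 270] -/
theorem IsSimple.surjective_or_eq_zero (h' : H'.IsSimple) (f : Hom H H') :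
    Function.Surjective f.toLinearMap ∨ f = Hom.zero H H' := by
  rcases h'.eq_bot_or_eq_top f.range with h0 | h1
  · right; exact f.eq_zero_iff_range_eq_bot.2 h0
  · left; rw [← LinearMap.range_eq_top, ← Hom.range_toSubmodule]; exact h1

/-- **Schur's lemma**: a morphism between simple mixed Hodge structures is an isomorphism or zero.
[cite: CattaniElZeinGriffithsLe2014, Thm. 3.2.18 and p. 270] -/
theorem IsSimple.bijective_or_eq_zero (h : H.IsSimple) (h' : H'.IsSimple) (f : Hom H H') :
    Function.Bijective f.toLinearMap ∨ f = Hom.zero H H' := by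
  rcases h.injective_or_eq_zero f with hi | h0
  · rcases h'.surjective_or_eq_zero f with hs | h0
    · exact Or.inl ⟨hi, hs⟩
    · exact Or.inr h0
  · exact Or.inr h0

/-- A non-zero morphism between simple MHS is an isomorphism. [cite: CattaniElZeinGriffithsLe2014, Thm. 3.2.18 and p. 270] -/
theorem IsSimple.bijective_of_ne_zero (h : H.IsSimple) (h' : H'.IsSimple) {f : Hom H H'} (hf : f ≠ Hom.zero H H') :
    Function.Bijective f.toLinearMap :=
  (h.bijective_or_eq_zero h' f).resolve_right hf

/-- **Schur's lemma for endomorphisms**: a non-zero endomorphism of a simple MHS is invertible in `End(H)`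
(`End(H)` is a division ring). [cite: CattaniElZeinGriffithsLe2014, Thm. 3.2.18 and p. 270] -/
theorem IsSimple.exists_inverse_of_ne_zero (h : H.IsSimple) {f : Hom H H} (hf : f ≠ Hom.zero H H) :
    ∃ g : Hom H H, g.comp f = Hom.id H ∧ f.comp g = Hom.id H :=
  ⟨f.inverse (h.bijective_of_ne_zero h hf), Hom.inverse_comp _ _, Hom.comp_inverse _ _⟩

/-- Between two simple MHS, either every morphism vanishes or they are isomorphic.
[cite: CattaniElZeinGriffithsLe2014, Thm. 3.2.18 and p. 270] -/
theorem IsSimple.forall_hom_eq_zero_or_exists_bijective (h : H.IsSimple) (h' : H'.IsSimple) :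
    (∀ f : Hom H H', f = Hom.zero H H') ∨ ∃ f : Hom H H', Function.Bijective f.toLinearMap := by
  by_cases hex : ∀ f : Hom H H', f = Hom.zero H H'
  · exact Or.inl hex
  · obtain ⟨f, hf⟩ := not_forall.1 hex
    exact Or.inr ⟨f, h.bijective_of_ne_zero h' hf⟩

/-- The image of a simple MHS under a non-zero morphism is a simple sub-MHS of the target. [cite: CattaniElZeinGriffithsLe2014, Thm. 3.2.18 and p. 270] -/
theorem IsSimple.range {f : Hom H H'} (h : H.IsSimple) (hf : f ≠ Hom.zero H H') : f.range.toMixedHodgeStructure.IsSimple := by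
  have hi : Function.Injective f.toLinearMap := (h.injective_or_eq_zero f).resolve_right hf
  exact h.of_bijective f.rangeRestrict (f.rangeRestrict_bijective_of_injective hi)

/-! ### §3 The pure dictionary -/

/-- **A pure Hodge structure `H₀` is a simple MHS iff `V ≠ 0` and `H₀` has no sub-Hodge structures other than `0`
and itself.** [cite: CattaniElZeinGriffithsLe2014, Ex. 3.2.23 (1) and p. 270] -/
theorem _root_.Literature.AlgebraicGeometry.Motives.HodgeStructure.isSimple_toMixedHodgeStructure_iff {n : ℤ}
    (H₀ : HodgeStructure V n) :
    H₀.toMixedHodgeStructure.IsSimple ↔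
      Nontrivial V ∧ ∀ S : HodgeStructure.SubHodgeStructure H₀, S.toSubmodule = ⊥ ∨ S.toSubmodule = ⊤ := by
  refine and_congr_right fun _ => ⟨fun h S => h S.toSubMixedHodgeStructure, fun h T => ?_⟩
  obtain ⟨S, hS⟩ := HodgeStructure.exists_subHodgeStructure_eq T
  rw [← hS]
  exact h S

end MixedHodgeStructure

end Literature.AlgebraicGeometry.Motives
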